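import Literature.Analysis.FluidPDE.BBGKYMarginals
import HarnessLib

/-!
# From the Liouville equation to the BBGKY hierarchy: reduction to an almost-everywhere
# statement with canonical boundary values

Companion file to `Literature.Analysis.FluidPDE.BBGKYMarginals`, preparing the discharge of the
named fact `Literature.Analysis.FluidPDE.liouville_imp_bbgky` (GST 2013 §4.3; CIP 1994
Thm 4.3.1). That fact asserts the existence of *versions* `F^{(s)}` of the (a.e.-defined)
marginals of a transported hard-sphere density which solve the mild BBGKY hierarchy at every
good `s`-configuration (`IsMildBBGKYSolutionOnGood`). This file isolates the measure-theoretic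
core of that statement from the bookkeeping of versions:

* `HardSphereFlow.not_mem_good_of_inner_neg` (§1): on the flat torus, a configuration in which
  particle `j` sits at `x_i + u`, `|u| ≤ ε`, with *approaching* velocities `u · (v_j - v_i) < 0`
  lies in the good set of **no** hard-sphere flow (free flight from it leaves `D_ε` at once,
  contradicting the `mem`/`free`/`locFinite` fields of `IsHardSphereTrajectory`). In particular
  (`lossConfig_not_mem_good`, `gainConfig_not_mem_good`) the configurations at which the BBGKY
  collision operator `bbgkyOp` (GST 2013 (4.3.6)) evaluates `F^{(s+1)}` with a *nonzero* weight
  `(ω · (v_{s+1} - v_i))_±` are never good, whence `bbgkyOp_congr_of_eqOn_compl_good`: the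
  collision term is blind to the values of its argument on the good set of any `(s+1)`-particle
  flow. Consequently the levels of `liouville_imp_bbgky` decouple: the Duhamel identity on
  `(Φ s).good` never sees the Duhamel-constrained values of `F^{(s+1)}`.
* The canonical boundary version `incomingLift` (§2): at an incoming contact configuration of the
  pair `(i, s+1)` take the value at its outgoing partner `collidePair`; this is the identification
  "`P₀(z) = P₀(z')`" of CIP 1994 (4.3.4) / Spohn (8) built into the *version* rather than assumed
  of the function. The honest marginals `transportedMarginal` of `1_{good} · W ∘ Φ^N_{-t}`
  **vanish** at every incoming contact configuration (an incoming pair is incoming in every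
  extension, and incoming contact configurations are not good), so — contrary to the last
  sentence of the docstring of `liouville_imp_bbgky` — the honest marginals themselves make the
  collision term vanish identically and do *not* solve the hierarchy; some boundary version is
  needed, and `incomingLift` is the one the printed proofs produce.
* `MildBBGKYae` (§2) is the resulting almost-everywhere, one-step, time-integrated hierarchy for
  the honest marginals with the canonical boundary version (CIP 1994 Thm 4.3.1 integrated in
  time; Spohn 2006 Prop. 5), and `liouville_imp_bbgky_of_ae` (§3) PROVES
  `liouville_imp_bbgky` from it: the version `F^{(s)}(t)` is the Duhamel right-hand side on
  `(Φ s).good` and `incomingLift` of the honest marginal elsewhere; it agrees with the honest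
  marginal a.e. because `D_ε^s ∖ good` is Liouville-null and marginals vanish off `D_ε^s`
  (`transportedMarginal_eq_zero_of_not_mem`).

What is deliberately NOT here: the proof of `MildBBGKYae` itself (special-flow representation of
the tagged–untagged collisions, CIP 1994 App. 4.A–4.B; flux identity, Spohn 2006 Lemma 2;
telescoping over collisions, Spohn 2006 Prop. 1), which is the remaining content of
`liouville_imp_bbgky`; no new named fact is introduced (D-0026).

## References

* C. Cercignani, R. Illner, M. Pulvirenti, *The Mathematical Theory of Dilute Gases*, Applied
  Mathematical Sciences 106, Springer (1994), §4.3 (assumption 2, (3.4)–(3.7)), Thm 4.3.1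
  (p. 71), Appendix 4.B (pp. 115–122). Bib key `CIPDiluteGases1994`.
* H. Spohn, *On the integrated form of the BBGKY hierarchy for hard spheres* (1985),
  arXiv:math-ph/0605068 (2006), (8), Prop. 1, Lemma 2, Prop. 5, Thm 11.
* I. Gallagher, L. Saint-Raymond, B. Texier, *From Newton to Boltzmann*, EMS (2013),
  arXiv:1208.5753v4 Part II Ch. 4 §§2–3, (4.3.5)–(4.3.8). Bib key
  `GallagherSaintRaymondTexier2013`.
-/

open MeasureTheory Metric Set Filter Topology
open scoped InnerProductSpace

namespace Literature.Analysis.FluidPDE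

noncomputable section

section Kinetic

variable {d : Type*}

/-! ## §0. Torus: the minimal-image vector is the shortest representative -/

namespace Torus

/-- Coordinatewise, the symmetric representative of `proj u` is no longer than `u`:
`|reprSym (proj u) k| = ‖u_k mod 1‖ = |u_k - round u_k| ≤ |u_k|`. [folklore] -/
theorem abs_reprSym_proj_apply_le (u : EuclideanSpace ℝ d) (k : d) :
    |reprSym (FunctionSpaces.Torus.proj u) k| ≤ |u k| := by
  rw [abs_reprSym_apply, FunctionSpaces.Torus.proj_apply, UnitAddCircle.norm_eq]
  simpa using round_le (u k) 0

variable [Fintype d]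

/-- The minimal-image vector of a displacement `u ∈ ℝ^d` on the unit torus is no longer than `u`:
`‖reprSym (proj u)‖ ≤ ‖u‖` (GST 2013 Ch. 4 intro: distance of nearest images). [folklore] -/
theorem norm_reprSym_proj_le (u : EuclideanSpace ℝ d) :
    ‖reprSym (FunctionSpaces.Torus.proj u)‖ ≤ ‖u‖ := by
  rw [EuclideanSpace.norm_eq, EuclideanSpace.norm_eq]
  refine Real.sqrt_le_sqrt (Finset.sum_le_sum fun k _ => ?_)
  rw [Real.norm_eq_abs, Real.norm_eq_abs]
  exact pow_le_pow_left₀ (abs_nonneg _) (abs_reprSym_proj_apply_le u k) 2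

end Torus

variable [Fintype d]

/-! ## §1. Approaching configurations are never good -/

section Approaching

variable {X : Type*} [TopologicalSpace X] {G : Geometry d X} {ε : ℝ} {n : ℕ}

/-- A hard-sphere trajectory is collision-free on some initial time interval `(0, t₁]`: its
collision times in `[0, 1]` are finite (`locFinite`), so the positive ones are bounded below by
a positive number. [folklore] -/
theorem IsHardSphereTrajectory.exists_pos_forall_not_mem_collisionTimes {γ : ℝ → Config n d X}
    (hγ : IsHardSphereTrajectory G ε n γ) :
    ∃ t₁ : ℝ, 0 < t₁ ∧ ∀ t, 0 < t → t ≤ t₁ → t ∉ collisionTimes G ε γ := by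
  classical
  set F : Finset ℝ := insert 1 ((hγ.locFinite 0 1).toFinset.filter fun τ => 0 < τ) with hF
  have hne : F.Nonempty := ⟨1, Finset.mem_insert_self _ _⟩
  have hpos : ∀ τ ∈ F, 0 < τ := by
    intro τ hτ
    rcases Finset.mem_insert.1 hτ with rfl | hτ
    · exact one_pos
    · exact (Finset.mem_filter.1 hτ).2
  have hmin := hpos _ (F.min'_mem hne)
  have hmin1 : F.min' hne ≤ 1 := F.min'_le 1 (Finset.mem_insert_self _ _)
  refine ⟨F.min' hne / 2, half_pos hmin, fun t ht htle hcol => ?_⟩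
  have htF : t ∈ F := by
    refine Finset.mem_insert_of_mem (Finset.mem_filter.2 ⟨?_, ht⟩)
    rw [Set.Finite.mem_toFinset]
    exact ⟨hcol, ht.le, by linarith⟩
  have := F.min'_le t htF
  linarith

end Approaching

namespace HardSphereFlow

variable {ε : ℝ} {n : ℕ}

/-- **Approaching configurations are not good** (flat torus). If particle `j` sits at
`x_i + u` with `|u| ≤ ε` and the pair approaches, `u · (v_j - v_i) < 0`, then the configuration
lies in the good set of no hard-sphere flow: the orbit of a good point is a hard-sphere
trajectory starting at it (`flow_zero`, `isTrajectory`), collision-free on some `(0, t₁]`, hence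
free flight there (`free`); but under free flight the minimal-image separation is at most
`|t (v_i - v_j) - u| < |u| ≤ ε` for small `t > 0` (`Torus.norm_reprSym_proj_le`), contradicting
`mem`. This is the elementary half of "incoming and outgoing configurations are identified,
the trajectory being right-continuous" (GST 2013 §4.1; CIP 1994 §4.3 (3.4)). [folklore] -/
theorem not_mem_good_of_inner_neg (Ψ : HardSphereFlow (Torus.geometry d) ε n)
    {z : Config n d (UnitAddTorus d)} {i j : Fin n} (hij : i ≠ j) {u : EuclideanSpace ℝ d}
    (hu : ‖u‖ ≤ ε) (hz : (z j).1 = (Torus.geometry d).translate (z i).1 u)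
    (hin : ⟪u, (z j).2 - (z i).2⟫_ℝ < 0) : z ∉ Ψ.good := by
  intro hgood
  have hγ := Ψ.isTrajectory z hgood
  obtain ⟨t₁, ht₁, hfree⟩ := hγ.exists_pos_forall_not_mem_collisionTimes
  set δ : EuclideanSpace ℝ d := (z i).2 - (z j).2 with hδ
  have hδu : 0 < ⟪δ, u⟫_ℝ := by
    have h1 : ⟪u, (z j).2 - (z i).2⟫_ℝ = -⟪δ, u⟫_ℝ := by
      rw [hδ, real_inner_comm, inner_sub_left, inner_sub_left]
      ring
    linarith
  have hδ0 : 0 < ‖δ‖ := by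
    refine norm_pos_iff.2 fun h => ?_
    rw [h, inner_zero_left] at hδu
    exact lt_irrefl _ hδu
  have hδ2 : 0 < ‖δ‖ ^ 2 := pow_pos hδ0 2
  set t : ℝ := min t₁ (⟪δ, u⟫_ℝ / ‖δ‖ ^ 2) with ht
  have htpos : 0 < t := lt_min ht₁ (div_pos hδu hδ2)
  have htle : t ≤ t₁ := min_le_left _ _
  have htle' : t * ‖δ‖ ^ 2 ≤ ⟪δ, u⟫_ℝ := (le_div_iff₀ hδ2).1 (min_le_right _ _)
  -- free flight on `(0, t]`
  have hflow : Ψ.flow t z = freeFlight (Torus.geometry d) t z := by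
    have h := hγ.free 0 t htpos.le fun τ hτ => hfree τ hτ.1 (hτ.2.trans htle)
    simpa [Ψ.flow_zero z hgood] using h
  -- the configuration at time `t` is in the hard-sphere domain
  have hmem := hγ.mem t
  simp only [hflow, mem_hardSphereDomain] at hmem
  have hεle := hmem i j hij
  -- the separation vector after free flight
  have hsep : (Torus.geometry d).sepVec (freeFlight (Torus.geometry d) t z i).1
      (freeFlight (Torus.geometry d) t z j).1 =
        Torus.reprSym (FunctionSpaces.Torus.proj (t • δ - u)) := by
    simp only [freeFlight_apply, Torus.geometry_translate, Torus.geometry_sepVec, hz]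
    congr 1
    rw [hδ, smul_sub]
    simp only [sub_eq_add_neg, FunctionSpaces.Torus.proj_add, FunctionSpaces.Torus.proj_neg]
    abel
  rw [hsep] at hεle
  have hle := Torus.norm_reprSym_proj_le (t • δ - u)
  -- `‖t δ - u‖² = t²‖δ‖² - 2 t ⟪δ, u⟫ + ‖u‖² < ‖u‖²`
  have hsq : ‖t • δ - u‖ ^ 2 < ‖u‖ ^ 2 := by
    rw [norm_sub_sq_real, norm_smul, real_inner_smul_left, Real.norm_eq_abs, abs_of_pos htpos,
      mul_pow]
    nlinarith
  have hlt : ‖t • δ - u‖ < ‖u‖ := lt_of_pow_lt_pow_left₀ 2 (norm_nonneg _) hsq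
  linarith

variable {s : ℕ}

omit [Fintype d] in
/-- The old particles of `appendParticle Zs x v`, indexed by `Fin.castSucc` (which is
`Fin.castAdd 1` by definition; cf. `appendParticle_castAdd`). [folklore] -/
private theorem appendParticle_castSucc_aux {X : Type*} (Zs : Config s d X) (x : X)
    (v : EuclideanSpace ℝ d) (k : Fin s) : appendParticle Zs x v (Fin.castSucc k) = Zs k :=
  appendParticle_castAdd Zs x v k

omit [Fintype d] in
/-- The new particle of `appendParticle Zs x v`, indexed by `Fin.last` (which is
`Fin.natAdd s 0`; cf. `appendParticle_last`). [folklore] -/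
private theorem appendParticle_last_aux {X : Type*} (Zs : Config s d X) (x : X)
    (v : EuclideanSpace ℝ d) : appendParticle Zs x v (Fin.last s) = (x, v) := by
  have h : Fin.last s = Fin.natAdd s (0 : Fin 1) := by ext; simp
  rw [h]
  exact appendParticle_last Zs x v

/-- **Loss configurations with nonzero weight are not good.** The incoming configuration
`(Z_s, x_i + ε ω, v)` of the loss term of GST 2013 (4.3.6), weight `(ω · (v - v_i))_-`, lies
in the good set of no `(s+1)`-particle hard-sphere flow whenever `ω · (v - v_i) < 0`. [folklore] -/
theorem lossConfig_not_mem_good (hε : 0 < ε)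
    (Ψ : HardSphereFlow (Torus.geometry d) ε (s + 1)) (Zs : Config s d (UnitAddTorus d))
    (i : Fin s) (ω : sphere (0 : EuclideanSpace ℝ d) 1) (v : EuclideanSpace ℝ d)
    (hb : ⟪(ω : EuclideanSpace ℝ d), v - (Zs i).2⟫_ℝ < 0) :
    lossConfig (Torus.geometry d) ε Zs i ω v ∉ Ψ.good := by
  refine Ψ.not_mem_good_of_inner_neg (i := Fin.castSucc i) (j := Fin.last s)
    (Fin.castSucc_lt_last i).ne (u := ε • (ω : EuclideanSpace ℝ d)) ?_ ?_ ?_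
  · rw [norm_smul, Real.norm_eq_abs, abs_of_pos hε, norm_eq_of_mem_sphere, mul_one]
  · simp only [lossConfig, appendParticle_last_aux, appendParticle_castSucc_aux]
  · simp only [lossConfig, appendParticle_last_aux, appendParticle_castSucc_aux, real_inner_smul_left]
    exact mul_neg_of_pos_of_neg hε hb

/-- **Gain configurations with nonzero weight are not good.** The configuration
`(…, x_i, v_i*, …, x_i + ε ω, v*)` of the gain term of GST 2013 (4.3.6), weight
`(ω · (v - v_i))_+`, carries the *pre-collisional* velocities `(v_i*, v*) = reflectVel ω (v_i, v)`,
for which `ω · (v* - v_i*) = -ω · (v - v_i)` (`inner_reflectVel_fst_sub_snd`); so for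
`ω · (v - v_i) > 0` it is approaching and lies in the good set of no `(s+1)`-particle flow. [folklore] -/
theorem gainConfig_not_mem_good (hε : 0 < ε)
    (Ψ : HardSphereFlow (Torus.geometry d) ε (s + 1)) (Zs : Config s d (UnitAddTorus d))
    (i : Fin s) (ω : sphere (0 : EuclideanSpace ℝ d) 1) (v : EuclideanSpace ℝ d)
    (hb : 0 < ⟪(ω : EuclideanSpace ℝ d), v - (Zs i).2⟫_ℝ) :
    gainConfig (Torus.geometry d) ε Zs i ω v ∉ Ψ.good := by
  have hω : (ω : EuclideanSpace ℝ d) ≠ 0 := ne_zero_of_mem_unit_sphere ω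
  refine Ψ.not_mem_good_of_inner_neg (i := Fin.castSucc i) (j := Fin.last s)
    (Fin.castSucc_lt_last i).ne (u := ε • (ω : EuclideanSpace ℝ d)) ?_ ?_ ?_
  · rw [norm_smul, Real.norm_eq_abs, abs_of_pos hε, norm_eq_of_mem_sphere, mul_one]
  · simp only [gainConfig, appendParticle_last_aux, appendParticle_castSucc_aux,
      Function.update_self]
  · simp only [gainConfig, appendParticle_last_aux, appendParticle_castSucc_aux,
      Function.update_self, real_inner_smul_left]
    refine mul_neg_of_pos_of_neg hε ?_
    have h := inner_reflectVel_fst_sub_snd (ω : EuclideanSpace ℝ d) hω ((Zs i).2, v)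
    have h' : ⟪(ω : EuclideanSpace ℝ d), (reflectVel (ω : EuclideanSpace ℝ d) ((Zs i).2, v)).2 -
        (reflectVel (ω : EuclideanSpace ℝ d) ((Zs i).2, v)).1⟫_ℝ =
        ⟪(ω : EuclideanSpace ℝ d), (Zs i).2 - v⟫_ℝ := by
      rw [← neg_sub, inner_neg_right, h, neg_neg]
    rw [h', ← neg_sub, inner_neg_right]
    linarith

/-- **The BBGKY collision term is blind to the good set.** If two `(s+1)`-particle functions
agree off the good set of some `(s+1)`-particle hard-sphere flow on the torus, their `i`-th
collision terms (GST 2013 (4.3.6)) coincide everywhere: the integrands agree pointwise, since a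
gain / loss configuration is evaluated with a nonzero weight only when it is approaching, hence
not good (`gainConfig_not_mem_good`, `lossConfig_not_mem_good`). [folklore] -/
theorem hsCollisionTerm_congr_of_eqOn_compl_good (hε : 0 < ε)
    (Ψ : HardSphereFlow (Torus.geometry d) ε (s + 1))
    {g g' : Config (s + 1) d (UnitAddTorus d) → ℝ} (hgg' : ∀ Z, Z ∉ Ψ.good → g Z = g' Z)
    (i : Fin s) (Zs : Config s d (UnitAddTorus d)) :
    hsCollisionTerm (Torus.geometry d) ε s i g Zs = hsCollisionTerm (Torus.geometry d) ε s i g' Zs := by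
  unfold hsCollisionTerm
  congr 1
  funext ω
  congr 1
  funext v
  rcases lt_trichotomy ⟪(ω : EuclideanSpace ℝ d), v - (Zs i).2⟫_ℝ 0 with hb | hb | hb
  · rw [max_eq_right hb.le, zero_mul, zero_mul,
      hgg' _ (Ψ.lossConfig_not_mem_good hε Zs i ω v hb)]
  · simp [hb]
  · rw [max_eq_right (neg_nonpos.2 hb.le), zero_mul, zero_mul,
      hgg' _ (Ψ.gainConfig_not_mem_good hε Zs i ω v hb)]

/-- The BBGKY collision operator `C_{s,s+1}` (GST 2013 (4.3.5)) on the torus is blind to the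
values of its argument on the good set of any `(s+1)`-particle hard-sphere flow
(`hsCollisionTerm_congr_of_eqOn_compl_good` summed over `i`). [folklore] -/
theorem bbgkyOp_congr_of_eqOn_compl_good (hε : 0 < ε)
    (Ψ : HardSphereFlow (Torus.geometry d) ε (s + 1))
    {g g' : Config (s + 1) d (UnitAddTorus d) → ℝ} (hgg' : ∀ Z, Z ∉ Ψ.good → g Z = g' Z)
    (N : ℕ) (Zs : Config s d (UnitAddTorus d)) :
    bbgkyOp (Torus.geometry d) ε N s g Zs = bbgkyOp (Torus.geometry d) ε N s g' Zs := by
  unfold bbgkyOp bbgkyCollisionOp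
  refine Finset.sum_congr rfl fun i _ => ?_
  rw [Ψ.hsCollisionTerm_congr_of_eqOn_compl_good hε hgg' i Zs]

/-- The good set is Lebesgue-conull in the hard-sphere domain: `volume (D_ε^n ∖ good) = 0`
(restatement of `measure_compl_good` for the Liouville measure `volume|_{D_ε^n}`). [folklore] -/
theorem volume_diff_good {X : Type*} [MeasureSpace X] [TopologicalSpace X] {G : Geometry d X}
    (Ψ : HardSphereFlow G ε n) : volume (hardSphereDomain G n ε \ Ψ.good) = 0 := by
  have h := Ψ.measure_compl_good
  rw [liouville_eq, Measure.restrict_apply Ψ.measurableSet_good.compl] at h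
  refine measure_mono_null (fun z hz => ?_) h
  exact ⟨hz.2, hz.1⟩

end HardSphereFlow

/-! ## §2. The canonical boundary version and the a.e. mild hierarchy -/

section Version

variable {X : Type*}

open scoped Classical in
/-- The **canonical boundary version** of an `(s+1)`-particle function `g`: at a configuration
in which the added particle `s+1` is at contact with some `i ≤ s`, `|x_i - x_{s+1}| = ε`, with
*incoming* velocities, take the value of `g` at the outgoing partner `collidePair i (s+1)`
(elastic reflection of `(v_i, v_{s+1})`, positions unchanged); elsewhere `g` itself. This builds
the identification of pre- and post-collisional values "`P₀(z) = P₀(z')`" (CIP 1994 §4.3 (3.4);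
Spohn 2006 (8): continuity along trajectories) into the version instead of assuming it of `g`.
If several `i` qualify (a surface-null set) the least index is used (`Fin.find`). [cite: CIPDiluteGases1994, §4.3 (3.4)] -/
def incomingLift (G : Geometry d X) (ε : ℝ) {s : ℕ} (g : Config (s + 1) d X → ℝ)
    (Z : Config (s + 1) d X) : ℝ :=
  if h : ∃ i : Fin s, ‖G.sepVec (Z (Fin.castSucc i)).1 (Z (Fin.last s)).1‖ = ε ∧
      IsIncoming G Z (Fin.castSucc i) (Fin.last s) then
    g (collidePair G (Fin.castSucc (Fin.find _ h)) (Fin.last s) Z)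
  else g Z

/-- If `g` takes the same value at `Z` and at each candidate partner `collidePair i (s+1) Z`,
the canonical boundary version of `g` at `Z` is `g Z`. [folklore] -/
theorem incomingLift_eq_self (G : Geometry d X) (ε : ℝ) {s : ℕ} {g : Config (s + 1) d X → ℝ}
    {Z : Config (s + 1) d X}
    (h : ∀ i : Fin s, g (collidePair G (Fin.castSucc i) (Fin.last s) Z) = g Z) :
    incomingLift G ε g Z = g Z := by
  unfold incomingLift
  split_ifs with h'
  · exact h _
  · rfl

/-- The canonical boundary version, level by level: the identity on `0`-particle functions,
`incomingLift` on `(k+1)`-particle functions. [folklore] -/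
def boundaryLift (G : Geometry d X) (ε : ℝ) : (s : ℕ) → (Config s d X → ℝ) → Config s d X → ℝ
  | 0, g => g
  | _ + 1, g => incomingLift G ε g

variable [MeasureSpace X] [TopologicalSpace X] {G : Geometry d X} {ε : ℝ} {N : ℕ}

/-- The **honest marginals of the transported density**: for flows `Φ` and an `N`-particle
initial density `W`, `f^{(s)}(t) := ∫ (1_{good} · W ∘ Φ^N_{-t})(Z_s, ·)`, i.e.
`nthMarginal N s` of the good-set-restricted transport (GST 2013 (4.3.2), (4.3.7);
CIP 1994 §4.3) — the right-hand side of the a.e. clause of `liouville_imp_bbgky`. [cite: GallagherSaintRaymondTexier2013, (4.3.2)] -/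
def transportedMarginal (Φ : (s : ℕ) → HardSphereFlow G ε s) (W : Config N d X → ℝ) (s : ℕ)
    (t : ℝ) : Config s d X → ℝ :=
  nthMarginal N s ((Φ N).good.indicator (hsTransport (Φ N) t W))

omit [MeasureSpace X] [TopologicalSpace X] in
/-- A sub-configuration violating the exclusion makes every extension violate it: if
`Z_s ∉ D_ε^s` then `(Z_s, Z_m) ∉ D_ε^{s+m}` (read along any cast of `Fin`). [folklore] -/
theorem append_not_mem_hardSphereDomain {s m n : ℕ} (h : n = s + m) {Zs : Config s d X}
    (hZs : Zs ∉ hardSphereDomain G s ε) (Zm : Config m d X) :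
    (fun i => Fin.append Zs Zm (Fin.cast h i)) ∉ hardSphereDomain G n ε := by
  intro hmem
  apply hZs
  rw [mem_hardSphereDomain] at hmem ⊢
  intro i j hij
  have hc : ∀ x : Fin (s + m), Fin.cast h (Fin.cast h.symm x) = x := fun x => Fin.ext rfl
  have := hmem (Fin.cast h.symm (Fin.castAdd m i)) (Fin.cast h.symm (Fin.castAdd m j))
    (fun hc' => hij (Fin.ext (by simpa using Fin.ext_iff.1 hc')))
  simpa [hc, Fin.append_left] using this

/-- The honest marginals vanish off the hard-sphere domain: if `Z_s ∉ D_ε^s` then every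
`N`-particle extension of `Z_s` is outside `D_ε^N ⊇ (Φ N).good`, so the integrand of
`transportedMarginal Φ W s t Z_s` is identically `0`. [folklore] -/
theorem transportedMarginal_eq_zero_of_not_mem (Φ : (s : ℕ) → HardSphereFlow G ε s)
    (W : Config N d X → ℝ) {s : ℕ} (t : ℝ) {Zs : Config s d X}
    (hZs : Zs ∉ hardSphereDomain G s ε) : transportedMarginal Φ W s t Zs = 0 := by
  unfold transportedMarginal nthMarginal
  split_ifs with hs
  · unfold marginal
    refine integral_eq_zero_of_ae (Eventually.of_forall fun Zm => ?_)
    refine Set.indicator_of_notMem (fun hgood => ?_) _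
    exact append_not_mem_hardSphereDomain (Nat.add_sub_of_le hs).symm hZs Zm
      ((Φ N).good_subset hgood)
  · rfl

/-- Off the hard-sphere domain the canonical boundary version of the honest marginal is the
honest marginal (both vanish, `collidePair` not moving particles). [folklore] -/
theorem boundaryLift_transportedMarginal_of_not_mem (Φ : (s : ℕ) → HardSphereFlow G ε s)
    (W : Config N d X → ℝ) (s : ℕ) (t : ℝ) {Zs : Config s d X}
    (hZs : Zs ∉ hardSphereDomain G s ε) :
    boundaryLift G ε s (transportedMarginal Φ W s t) Zs = transportedMarginal Φ W s t Zs := by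
  cases s with
  | zero => rfl
  | succ k =>
    refine incomingLift_eq_self G ε fun i => ?_
    rw [transportedMarginal_eq_zero_of_not_mem Φ W t hZs,
      transportedMarginal_eq_zero_of_not_mem Φ W t]
    rwa [collidePair_mem_hardSphereDomain_iff]

/-- **Honest marginals vanish at approaching configurations** (flat torus): if in `Z_s`
particle `j` sits at `x_i + u`, `|u| ≤ ε`, with approaching velocities `u · (v_j - v_i) < 0` — in
particular at every incoming contact configuration, i.e. at every configuration at which
`bbgkyOp` evaluates its argument with a nonzero weight (`lossConfig`, `gainConfig`) — then every
`N`-particle extension of `Z_s` contains the same approaching pair, hence is not good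
(`HardSphereFlow.not_mem_good_of_inner_neg`), and `transportedMarginal Φ W s t Z_s = 0`. So the
honest marginals fed to `bbgkyOp` produce an identically vanishing collision term: a boundary
version such as `incomingLift` is indispensable in `liouville_imp_bbgky`. [folklore] -/
theorem transportedMarginal_eq_zero_of_inner_neg
    (Φ : (s : ℕ) → HardSphereFlow (Torus.geometry d) ε s) (W : Config N d (UnitAddTorus d) → ℝ)
    {s : ℕ} (t : ℝ) {Zs : Config s d (UnitAddTorus d)} {i j : Fin s} (hij : i ≠ j)
    {u : EuclideanSpace ℝ d} (hu : ‖u‖ ≤ ε)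
    (hz : (Zs j).1 = (Torus.geometry d).translate (Zs i).1 u)
    (hin : ⟪u, (Zs j).2 - (Zs i).2⟫_ℝ < 0) : transportedMarginal Φ W s t Zs = 0 := by
  unfold transportedMarginal nthMarginal
  split_ifs with hs
  · unfold marginal
    refine integral_eq_zero_of_ae (Eventually.of_forall fun Zm => ?_)
    refine Set.indicator_of_notMem (fun hgood => ?_) _
    have hc : ∀ x : Fin (s + (N - s)),
        Fin.cast (Nat.add_sub_of_le hs).symm (Fin.cast (Nat.add_sub_of_le hs) x) = x :=
      fun x => Fin.ext rfl
    refine (Φ N).not_mem_good_of_inner_neg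
      (i := Fin.cast (Nat.add_sub_of_le hs) (Fin.castAdd (N - s) i))
      (j := Fin.cast (Nat.add_sub_of_le hs) (Fin.castAdd (N - s) j))
      (fun hc' => hij (Fin.ext (by simpa using Fin.ext_iff.1 hc'))) hu ?_ ?_ hgood
    · simpa [hc, Fin.append_left] using hz
    · simpa [hc, Fin.append_left] using hin
  · rfl

/-- **The mild BBGKY hierarchy almost everywhere, with canonical boundary values** (the
conclusion, for given flows `Φ`, initial density `W` and horizon `T`): for every `s ≤ N` and
`t ∈ [0, T]`, for a.e. good `Z_s`,
`f^{(s)}(t, Z_s) = f^{(s)}(0, Φ^s_{-t} Z_s) + ∫_0^t (C_{s,s+1} f♭^{(s+1)}(τ))(Φ^s_{τ-t} Z_s) dτ`,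
where `f^{(s)}` are the honest marginals `transportedMarginal` of `1_{good} · W ∘ Φ^N_{-t}` and
`f♭ = incomingLift f` is their canonical boundary version. This is CIP 1994 Thm 4.3.1,
`d/dt [P^{(s)}(T_t z^s, t)] = (Q_{s+1} P^{(s+1)})(T_t z^s, t)` for a.e. `z^s`, integrated in
time (their (3.7); the boundary values of `P^{(s+1)}` being fixed by assumption 2 / (3.4)), and
Spohn 2006 Prop. 5; GST 2013 (4.3.8) is the same identity stated for continuous densities. [cite: CIPDiluteGases1994, Thm 4.3.1] -/
def MildBBGKYae (T : ℝ) (G : Geometry d X) (ε : ℝ) (N : ℕ) (Φ : (s : ℕ) → HardSphereFlow G ε s)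
    (W : Config N d X → ℝ) : Prop :=
  ∀ s ≤ N, ∀ t ∈ Icc 0 T, ∀ᵐ Zs : Config s d X, Zs ∈ (Φ s).good →
    transportedMarginal Φ W s t Zs =
      transportedMarginal Φ W s 0 ((Φ s).flow (-t) Zs) +
        ∫ τ in (0 : ℝ)..t, bbgkyOp G ε N s (incomingLift G ε (transportedMarginal Φ W (s + 1) τ))
          ((Φ s).flow (-(t - τ)) Zs)

end Version

/-! ## §3. The reduction -/

section Reduction

variable {ε : ℝ} {N : ℕ}

/-- Unfolding of `boundaryLift` at a successor level. [folklore] -/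
@[simp]
theorem boundaryLift_succ {X : Type*} (G : Geometry d X) (ε : ℝ) {s : ℕ}
    (g : Config (s + 1) d X → ℝ) : boundaryLift G ε (s + 1) g = incomingLift G ε g := rfl

/-- **Versions solving the hierarchy on the good sets, from the a.e. hierarchy.** On the flat
torus with `0 < ε`, if the honest marginals of `1_{good} · W ∘ Φ^N_{-t}` satisfy the mild BBGKY
hierarchy a.e. with canonical boundary values on `[0, T]` (`MildBBGKYae`; CIP 1994 Thm 4.3.1,
Spohn 2006 Prop. 5), then they admit versions forming a mild solution of the BBGKY hierarchy on
the good sets (`IsMildBBGKYSolutionOnGood`). The version is `F^{(s)}(t, Z_s) :=` the Duhamel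
right-hand side (built on `incomingLift f^{(s+1)}`) for `Z_s ∈ (Φ s).good`, and
`boundaryLift f^{(s)}(t)` elsewhere. The Duhamel identity on the good set holds by construction
(`flow_zero`, `mapsTo_good`, and `bbgkyOp_congr_of_eqOn_compl_good`: the collision term does not
see the values of `F^{(s+1)}` on `(Φ (s+1)).good`), and `F^{(s)}(t) = f^{(s)}(t)` a.e. because
the hypothesis gives it a.e. on the good set, `D_ε^s ∖ good` is null
(`HardSphereFlow.volume_diff_good`) and both sides vanish off `D_ε^s`
(`boundaryLift_transportedMarginal_of_not_mem`). No hypothesis on `W` is needed. [folklore] -/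
theorem MildBBGKYae.exists_isMildBBGKYSolutionOnGood (hε : 0 < ε)
    {Φ : (s : ℕ) → HardSphereFlow (Torus.geometry d) ε s} {T : ℝ}
    {W : Config N d (UnitAddTorus d) → ℝ} (hae : MildBBGKYae T (Torus.geometry d) ε N Φ W) :
    ∃ F : (s : ℕ) → ℝ → Config s d (UnitAddTorus d) → ℝ,
      IsMildBBGKYSolutionOnGood T (Torus.geometry d) ε N Φ F ∧
        ∀ s ≤ N, ∀ t ∈ Icc 0 T,
          F s t =ᵐ[volume] nthMarginal N s ((Φ N).good.indicator (hsTransport (Φ N) t W)) := by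
  classical
  let F : (s : ℕ) → ℝ → Config s d (UnitAddTorus d) → ℝ := fun s t Zs =>
    if Zs ∈ (Φ s).good then
      transportedMarginal Φ W s 0 ((Φ s).flow (-t) Zs) +
        ∫ τ in (0 : ℝ)..t, bbgkyOp (Torus.geometry d) ε N s
          (incomingLift (Torus.geometry d) ε (transportedMarginal Φ W (s + 1) τ))
          ((Φ s).flow (-(t - τ)) Zs)
    else boundaryLift (Torus.geometry d) ε s (transportedMarginal Φ W s t) Zs
  have hF_good : ∀ s t Zs, Zs ∈ (Φ s).good → F s t Zs =
      transportedMarginal Φ W s 0 ((Φ s).flow (-t) Zs) +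
        ∫ τ in (0 : ℝ)..t, bbgkyOp (Torus.geometry d) ε N s
          (incomingLift (Torus.geometry d) ε (transportedMarginal Φ W (s + 1) τ))
          ((Φ s).flow (-(t - τ)) Zs) :=
    fun s t Zs hZs => if_pos hZs
  have hF_bad : ∀ s t Zs, Zs ∉ (Φ s).good →
      F s t Zs = boundaryLift (Torus.geometry d) ε s (transportedMarginal Φ W s t) Zs :=
    fun s t Zs hZs => if_neg hZs
  -- the collision term of `F (s+1) τ` is that of the canonical boundary version
  have hC : ∀ (s : ℕ) (τ : ℝ) (Ys : Config s d (UnitAddTorus d)),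
      bbgkyOp (Torus.geometry d) ε N s (F (s + 1) τ) Ys =
        bbgkyOp (Torus.geometry d) ε N s
          (incomingLift (Torus.geometry d) ε (transportedMarginal Φ W (s + 1) τ)) Ys :=
    fun s τ Ys => (Φ (s + 1)).bbgkyOp_congr_of_eqOn_compl_good hε
      (fun Z hZ => by rw [hF_bad (s + 1) τ Z hZ, boundaryLift_succ]) N Ys
  refine ⟨F, ?_, ?_⟩
  · -- the Duhamel identity on the good sets, by construction
    intro s _ t _ Zs hZs
    have hY : (Φ s).flow (-t) Zs ∈ (Φ s).good := (Φ s).mapsTo_good (-t) hZs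
    have h0 : F s 0 ((Φ s).flow (-t) Zs) = transportedMarginal Φ W s 0 ((Φ s).flow (-t) Zs) := by
      rw [hF_good s 0 _ hY]
      simp only [neg_zero, intervalIntegral.integral_same, add_zero]
      rw [(Φ s).flow_zero _ hY]
    rw [hF_good s t Zs hZs, hsTransport_apply, h0]
    simp only [hsTransport_apply, hC]
  · -- agreement a.e. with the honest marginals
    intro s hs t ht
    have hnull : ∀ᵐ Zs : Config s d (UnitAddTorus d),
        Zs ∉ hardSphereDomain (Torus.geometry d) s ε \ (Φ s).good :=
      measure_eq_zero_iff_ae_notMem.1 (Φ s).volume_diff_good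
    filter_upwards [hae s hs t ht, hnull] with Zs h1 h2
    show F s t Zs = transportedMarginal Φ W s t Zs
    by_cases hZs : Zs ∈ (Φ s).good
    · rw [hF_good s t Zs hZs]
      exact (h1 hZs).symm
    · have hZD : Zs ∉ hardSphereDomain (Torus.geometry d) s ε := fun hD => h2 ⟨hD, hZs⟩
      rw [hF_bad s t Zs hZs]
      exact boundaryLift_transportedMarginal_of_not_mem Φ W s t hZD

/-- **`liouville_imp_bbgky` from the a.e. hierarchy.** If, in the setting of
`liouville_imp_bbgky` (flat torus, `0 < ε ≤ 1/2`, symmetric Lanford-class density continuous on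
`D_ε^N` and vanishing off it), the honest marginals satisfy the mild BBGKY hierarchy a.e. with
canonical boundary values (`MildBBGKYae`; CIP 1994 Thm 4.3.1, Spohn 2006 Prop. 5), then
`liouville_imp_bbgky` holds (`MildBBGKYae.exists_isMildBBGKYSolutionOnGood`). This reduces the
named fact `liouville_imp_bbgky` to the a.e. identity of CIP 1994 Thm 4.3.1 in the present
conventions. [folklore] -/
theorem liouville_imp_bbgky_of_ae
    (h : ∀ {ε : ℝ} (_hε : 0 < ε) (_hε' : ε ≤ 2⁻¹) {N : ℕ}
      (Φ : (s : ℕ) → HardSphereFlow (Torus.geometry d) ε s) {T : ℝ} (_hT : 0 ≤ T)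
      {W : Config N d (UnitAddTorus d) → ℝ} (_hW : IsSymmetricFn W)
      (_hWc : ContinuousOn W (hardSphereDomain (Torus.geometry d) N ε)) (_hWi : Integrable W)
      (_hWb : ∃ C β : ℝ, 0 < β ∧ ∀ z, |W z| ≤ C * Real.exp (-β * configEnergy z))
      (_hWD : ∀ z ∉ hardSphereDomain (Torus.geometry d) N ε, W z = 0),
      MildBBGKYae T (Torus.geometry d) ε N Φ W) :
    liouville_imp_bbgky (d := d) :=
  fun hε hε' _ Φ _ hT _ hW hWc hWi hWb hWD =>
    (h hε hε' Φ hT hW hWc hWi hWb hWD).exists_isMildBBGKYSolutionOnGood hε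

end Reduction

end Kinetic

end

end Literature.Analysis.FluidPDE
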